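import Summits.ResolutionOfSingularities.ResolutionOfSingularities.Theorems.WeightedInvariantIota3CurveFracTieZeroSigmaReduction
import Summits.ResolutionOfSingularities.ResolutionOfSingularities.Theorems.WeightedInvariantIota3CurveFracTieZeroIsolated
import Summits.ResolutionOfSingularities.ResolutionOfSingularities.Theorems.WeightedInvariantIotaOrderOffExceptional
import HarnessLib

/-!
# (ISO) PROVED at the pinned successor: the transform of a fractional-slope tied curve centre has ISOLATED equimultiple locus
# (door `HypersurfaceCentreConstruction`, stmt-ResolutionOfSingularities-19897, stub `stub_keyRungGrHomLE_three`)

Helper for `stub_keyRungGrHomLE_three` (def-free, `--supports 19897`).  Assembly of this hand's …Iota3CurveFracTieZeroSigmaReduction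
(`ε = τ = 0` at the curve-centre position), …Iota3CurveFracTieZeroIsolated ((ISO) ⟸ (ISO-OFF)) and …IotaOrderOffExceptional (off `V(t⁻¹)`
the order is the order downstairs).

* **`Iota3.iotaOrd_localization_lt_of_not_le`** — at a curve-centre door position (`topStratum ι₀ S f = V(P)`, `P ≠ 𝔪`, `f ∈ P`), the ORDER
  drops at every prime `𝔮₀ ⊉ P`: `ι₀ = (ν ; 0 ; 0)` at `S`, so a strict drop of `ι₀` off `V(P)` is a drop of `ν`.
* **`Iota3.iotaOrd_transform_lt_of_tInv_not_mem_aux`** — (ISO-OFF) PROVED: at a prime `𝔮 ⊆ 𝔫` of the cobordant algebra with `t⁻¹ ∉ 𝔮`,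
  `iotaOrd (B_𝔮) (g/1) < iotaOrd S f` (`g` is a unit multiple of `f` there; `ord_{B_𝔮}(f) = ord_{S_{𝔮∩S}}(f)`; `𝔮 ∩ S ∌ x` because
  `x = t⁻¹·X` with `X ∉ 𝔫` — else the vertex ideal `⊆ (Y, X) ⊆ 𝔫`, using `Y = W ∈ 𝔫`).
* **`Iota3.isIsolatedPosition_transform`** (+ `_aux`) — **(ISO) PROVED**: at the pinned `t`-homogeneous successor `𝔫 = (t⁻¹, z, W)` of a
  fractional-slope curve centre tied at `λ = 0` (AQS-adapted normal form `f = c y^ν + h`, any presentation of `J₃ᵗ = 𝒥((y,x);(b,1))`), every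
  saturated transform of stationary order has `topStratum iotaOrd (B_𝔫) (g/1) = {𝔪}`.

[OURS · L1 W4.3 · audit glue; AI work, weaker than expert review; nothing here is a statement of the manuscript under review
(Hironaka 2017, [claim: Hironaka2017, status: under-review]).]

## References

* J. Włodarczyk, *Functorial resolution by torus actions*, arXiv:2203.03090, Def. 2.3.5, §3.3. [Wlodarczyk2022]
* hand -9, TIE-LOCUS.md §2 (crux directory; OURS).
-/

noncomputable section

set_option linter.dupNamespace false -- mandated namespace of this single-conjunct summit

open IsLocalRing Literature.AlgebraicGeometry.Resolution
open Summit.ResolutionOfSingularities.ResolutionOfSingularities.Theorems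
open Summit.ResolutionOfSingularities.ResolutionOfSingularities.Theorems.ContactCylinder
open scoped LaurentPolynomial

namespace Summit.ResolutionOfSingularities.ResolutionOfSingularities.Cruxes.HypersurfaceCentreConstruction.LocalEngine

namespace Iota3

/-! ## §1 Off the centre the order drops -/

/-- **At a curve-centre door position the ORDER drops at every prime `𝔮₀ ⊉ P`** (`S` regular local of Krull dimension `≤ 3`,
`topStratum ι₀ S f = V(P)`, `P ≠ 𝔪`, `f ∈ P ∩ (𝔪^ν ∖ 𝔪^{ν+1})`): `ι₀(S, f) = (ν ; 0 ; 0)`, so the strict drop of `ι₀` off `V(P)` ((c7) +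
definition of the top stratum) is a drop of the order letter. [OURS · L1 W4.3] -/
theorem iotaOrd_localization_lt_of_not_le {S : Type} [CommRing S] [IsRegularLocalRing S] {f : S} (hdim : ringKrullDim S ≤ 3)
    (hf0 : f ≠ 0) (P : Ideal S) [P.IsPrime] (hfP : f ∈ P) (hE : topStratum iotaOrdEpsTau S f = {𝔮 | P ≤ 𝔮.asIdeal})
    (hPm : P ≠ maximalIdeal S) {ν : ℕ} (hfν : f ∈ maximalIdeal S ^ ν) (hfν1 : f ∉ maximalIdeal S ^ (ν + 1))
    (𝔮₀ : Ideal S) [𝔮₀.IsPrime] (h𝔮₀ : ¬ P ≤ 𝔮₀) :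
    iotaOrd (Localization.AtPrime 𝔮₀) (algebraMap S (Localization.AtPrime 𝔮₀) f) < iotaOrd S f := by
  have hmon := iotaOrdEpsTau_generizationMonotone S 𝔮₀ f
  have hne : iotaOrdEpsTau (Localization.AtPrime 𝔮₀) (algebraMap S (Localization.AtPrime 𝔮₀) f) ≠ iotaOrdEpsTau S f := by
    intro h
    have hmem : (⟨𝔮₀, ‹_›⟩ : PrimeSpectrum S) ∈ topStratum iotaOrdEpsTau S f := h
    rw [hE] at hmem
    exact h𝔮₀ hmem
  have hlt := lt_of_le_of_ne hmon hne
  have hε := iotaEps_eq_zero_of_topStratum_eq_of_ne hdim hf0 P hfP hE hPm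
  have hτ := iotaTau_eq_zero_of_topStratum_eq_of_ne hdim P hE hPm
  rw [iotaOrdEpsTau_lt_iff] at hlt
  rcases hlt with h1 | ⟨-, h2⟩
  · rw [iotaOrdEps_lt_iff] at h1
    rcases h1 with h | ⟨-, h⟩
    · have hν : iotaOrd S f = ν := (iotaOrd_eq_natCast_iff S f ν).mpr ⟨hfν, hfν1⟩
      exact h
    · rw [hε] at h
      exact (lt_irrefl (0 : Ordinal) (lt_of_le_of_lt zero_le h)).elim
  · rw [hτ] at h2
    exact (lt_irrefl (0 : Ordinal) (lt_of_le_of_lt zero_le h2)).elim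

/-! ## §2 (ISO-OFF) and (ISO) -/

/-- **(ISO-OFF) PROVED** (`![y, x]`-presentation, generalized filtration `I`): at a prime `𝔮 ⊆ 𝔫` of the cobordant algebra of
`𝒥((y,x);(b,1))` with `t⁻¹ ∉ 𝔮`, where `𝔫 ∋ W`, `y = (t⁻¹)^b W`, `𝔫` off the vertex: `iotaOrd (B_𝔮) (g/1) < iotaOrd S f` for every
factorisation `f = (t⁻¹)ᵃ g`. [OURS · L1 W4.3 · (ISO-OFF)] [cite: Wlodarczyk2022, Def. 2.3.5] -/
theorem iotaOrd_transform_lt_of_tInv_not_mem_aux {S : Type} [CommRing S] [IsRegularLocalRing S] {f : S} (hdim : ringKrullDim S ≤ 3)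
    (hf0 : f ≠ 0) (P : Ideal S) [P.IsPrime] (hfP : f ∈ P) (hE : topStratum iotaOrdEpsTau S f = {𝔮 | P ≤ 𝔮.asIdeal})
    (hPm : P ≠ maximalIdeal S) {ν : ℕ} (hfν : f ∈ maximalIdeal S ^ ν) (hfν1 : f ∉ maximalIdeal S ^ (ν + 1))
    {y x : S} {b : ℕ} (hPeq : P = Ideal.span {x, y})
    {I : ℕ → Ideal S} (hI : I = weightedMonomialIdeal ![y, x] ![b, 1])
    (𝔫 : Ideal (extReesAlgebra I)) (hV : ¬ extReesAlgebra.vertexIdeal I ≤ 𝔫)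
    (W : extReesAlgebra I) (hW : algebraMap S _ y = extReesAlgebra.tInv I ^ b * W) (hW𝔫 : W ∈ 𝔫)
    {a : ℕ} {g : extReesAlgebra I} (hfg : algebraMap S _ f = extReesAlgebra.tInv I ^ a * g)
    (𝔮 : Ideal (extReesAlgebra I)) [𝔮.IsPrime] (hle : 𝔮 ≤ 𝔫) (hT : extReesAlgebra.tInv I ∉ 𝔮) :
    iotaOrd (Localization.AtPrime 𝔮) (algebraMap _ (Localization.AtPrime 𝔮) g) < iotaOrd S f := by
  subst hI
  -- `Y = W` (cancel the unit `t⁻¹` of `S[t, t⁻¹]`)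
  have hY : LocalGameEFTPointMove.uT ![y, x] ![b, 1] 0 = W := by
    have h1 := LocalGameEFTCylinder.algebraMap_y_eq.symm.trans hW
    have h2 := congrArg (fun e : extReesAlgebra (weightedMonomialIdeal ![y, x] ![b, 1]) => (e : S[T;T⁻¹])) h1
    simp only [Subalgebra.coe_mul, Subalgebra.coe_pow, extReesAlgebra.coe_tInv] at h2
    exact Subtype.ext (((LaurentPolynomial.isUnit_T (-1 : ℤ)).pow b).mul_right_injective h2)
  -- `X ∉ 𝔫` (else the vertex ideal `⊆ (Y, X) ⊆ 𝔫`)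
  have hX : LocalGameEFTPointMove.uT ![y, x] ![b, 1] 1 ∉ 𝔫 := by
    intro hX
    apply hV ((LocalGameEFTPointMove.vertexIdeal_le_span_range_uT ![y, x] ![b, 1]).trans (Ideal.span_le.mpr ?_))
    rintro _ ⟨i, rfl⟩
    fin_cases i
    · exact (hY ▸ hW𝔫 :)
    · exact hX
  -- `x ∉ 𝔮 ∩ S`, so `P ⊄ 𝔮 ∩ S`
  have hx : x ∉ 𝔮.comap (algebraMap S (extReesAlgebra (weightedMonomialIdeal ![y, x] ![b, 1]))) := by
    intro hx
    have h1 := Ideal.mem_comap.mp hx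
    rw [LocalGameEFTCylinder.algebraMap_x_eq, pow_one] at h1
    rcases (Ideal.IsPrime.mem_or_mem ‹_› h1) with h | h
    · exact hT h
    · exact hX (hle h)
  have hP : ¬ P ≤ 𝔮.comap (algebraMap S (extReesAlgebra (weightedMonomialIdeal ![y, x] ![b, 1]))) := fun h =>
    hx (h (hPeq ▸ Ideal.subset_span (Set.mem_insert x {y})))
  -- `g` is a unit multiple of `f` in `B_𝔮`, and the order of `f` there is the order downstairs
  haveI : (𝔮.comap (algebraMap S (extReesAlgebra (weightedMonomialIdeal ![y, x] ![b, 1])))).IsPrime := Ideal.IsPrime.comap _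
  have hunit : IsUnit (algebraMap (extReesAlgebra (weightedMonomialIdeal ![y, x] ![b, 1])) (Localization.AtPrime 𝔮)
      (extReesAlgebra.tInv (weightedMonomialIdeal ![y, x] ![b, 1]))) :=
    IsLocalization.map_units (Localization.AtPrime 𝔮) (⟨_, hT⟩ : 𝔮.primeCompl)
  have h1 : iotaOrd (Localization.AtPrime 𝔮) (algebraMap _ (Localization.AtPrime 𝔮)
      (algebraMap S (extReesAlgebra (weightedMonomialIdeal ![y, x] ![b, 1])) f)) =
      iotaOrd (Localization.AtPrime 𝔮) (algebraMap _ (Localization.AtPrime 𝔮) g) := by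
    rw [hfg, map_mul, map_pow]
    exact iotaOrd_unitInvariant _ _ _ (hunit.pow a)
  rw [← h1, iotaOrd_extRees_atPrime_eq_of_tInv_not_mem _ 𝔮 hT f]
  exact iotaOrd_localization_lt_of_not_le hdim hf0 P hfP hE hPm hfν hfν1 _ hP

/-- **(ISO) PROVED at the pinned successor** (`![y, x]`-presentation, generalized filtration `I`): at a curve-centre door position with
AQS-adapted normal form `f = c y^ν + h` (`h ∈ 𝒥_{bν+1}((y,x);(b,1))`, `J₃ᵗ = 𝒥((y,x);(b,1))`), at `𝔫 = (t⁻¹, z, W)` (`y = (t⁻¹)^b W`) off the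
vertex, every saturated transform `g` of stationary order has `topStratum iotaOrd (B_𝔫) (g/1) = {𝔪}`. [OURS · L1 W4.3 · (ISO)]
[cite: Wlodarczyk2022, §3.3] -/
theorem isIsolatedPosition_transform_aux (p : ℕ) (k₀ : Type) [Field k₀] [CharP k₀ p] [PerfectField k₀]
    (S : Type) [CommRing S] [IsRegularLocalRing S] [Algebra k₀ S] [Algebra.EssFiniteType k₀ S]
    {f : S} (hd : ringKrullDim S = 3) (hf0 : f ≠ 0) (hf2 : f ∈ (maximalIdeal S) ^ 2)
    (P : Ideal S) [P.IsPrime] (hfP : f ∈ P) (hE : topStratum iotaOrdEpsTau S f = {𝔮 | P ≤ 𝔮.asIdeal})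
    (hP1 : ¬ ringKrullDim (Localization.AtPrime P) ≤ 1) (hPm : P ≠ maximalIdeal S)
    {y x z : S} {b ν : ℕ} {c h : S} (hyxz : Ideal.span (Set.range ![y, x, z]) = maximalIdeal S)
    (hrk : (maximalIdeal S).spanFinrank = 3) (hPeq : P = Ideal.span {x, y}) (hb : 1 ≤ b)
    (hfν : f ∈ maximalIdeal S ^ ν) (hfν1 : f ∉ maximalIdeal S ^ (ν + 1)) (hadm : f ∈ weightedMonomialIdeal ![y, x] ![b, 1] (b * ν))
    (hc : IsUnit c) (hh : h ∈ weightedMonomialIdeal ![y, x] ![b, 1] (b * ν + 1)) (hf : f = c * y ^ ν + h)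
    {I : ℕ → Ideal S} (hI : I = weightedMonomialIdeal ![y, x] ![b, 1]) (hJ : ∀ m : ℕ, I m = jFlatT S f m)
    (𝔫 : Ideal (extReesAlgebra I)) [𝔫.IsPrime] (hV : ¬ extReesAlgebra.vertexIdeal I ≤ 𝔫)
    (W : extReesAlgebra I) (hW : algebraMap S _ y = extReesAlgebra.tInv I ^ b * W)
    (h𝔫 : 𝔫 = Ideal.span {extReesAlgebra.tInv I, algebraMap S _ z, W})
    {a : ℕ} {g : extReesAlgebra I} (hfg : algebraMap S _ f = extReesAlgebra.tInv I ^ a * g) (hTg : ¬ extReesAlgebra.tInv I ∣ g)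
    (hord : iotaOrd (Localization.AtPrime 𝔫) (algebraMap _ (Localization.AtPrime 𝔫) g) = iotaOrd S f) :
    IsIsolatedPosition (Localization.AtPrime 𝔫) (algebraMap _ (Localization.AtPrime 𝔫) g) := by
  have hW𝔫 : W ∈ 𝔫 := by rw [h𝔫]; exact Ideal.subset_span (by simp)
  exact isIsolatedPosition_transform_of_offExceptional_aux p k₀ S hd hf0 hf2 P hE hP1 hyxz hrk hPeq hb hfν1 hadm hc hh hf hI hJ 𝔫 hV W
    hW h𝔫 hfg hTg hord fun 𝔮 _ hle hT =>
      iotaOrd_transform_lt_of_tInv_not_mem_aux (le_of_eq hd) hf0 P hfP hE hPm hfν hfν1 hPeq hI 𝔫 hV W hW hW𝔫 hfg 𝔮 hle hT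

/-- **(ISO) PROVED at the pinned successor, every presentation `(u, w)` of `J₃ᵗ = 𝒥((y,x);(b,1))`.** [OURS · L1 W4.3 · (ISO)]
[cite: Wlodarczyk2022, §3.3] -/
theorem isIsolatedPosition_transform (p : ℕ) (k₀ : Type) [Field k₀] [CharP k₀ p] [PerfectField k₀]
    (S : Type) [CommRing S] [IsRegularLocalRing S] [Algebra k₀ S] [Algebra.EssFiniteType k₀ S]
    {f : S} (hd : ringKrullDim S = 3) (hf0 : f ≠ 0) (hf2 : f ∈ (maximalIdeal S) ^ 2)
    (P : Ideal S) [P.IsPrime] (hfP : f ∈ P) (hE : topStratum iotaOrdEpsTau S f = {𝔮 | P ≤ 𝔮.asIdeal})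
    (hP1 : ¬ ringKrullDim (Localization.AtPrime P) ≤ 1) (hPm : P ≠ maximalIdeal S)
    {y x z : S} {b ν : ℕ} {c h : S} (hyxz : Ideal.span (Set.range ![y, x, z]) = maximalIdeal S)
    (hrk : (maximalIdeal S).spanFinrank = 3) (hPeq : P = Ideal.span {x, y}) (hb : 1 ≤ b)
    (hfν : f ∈ maximalIdeal S ^ ν) (hfν1 : f ∉ maximalIdeal S ^ (ν + 1)) (hadm : f ∈ weightedMonomialIdeal ![y, x] ![b, 1] (b * ν))
    (hc : IsUnit c) (hh : h ∈ weightedMonomialIdeal ![y, x] ![b, 1] (b * ν + 1)) (hf : f = c * y ^ ν + h)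
    {n : ℕ} (u : Fin n → S) (w : Fin n → ℕ) (hpres : ∀ m : ℕ, weightedMonomialIdeal u w m = weightedMonomialIdeal ![y, x] ![b, 1] m)
    (hJ : ∀ m : ℕ, weightedMonomialIdeal u w m = jFlatT S f m)
    (𝔫 : Ideal (cobordantAlgebra' u w)) [𝔫.IsPrime] (hV : ¬ extReesAlgebra.vertexIdeal (weightedMonomialIdeal u w) ≤ 𝔫)
    (W : cobordantAlgebra' u w) (hW : algebraMap S (cobordantAlgebra' u w) y = cobordantT' u w ^ b * W)
    (h𝔫 : 𝔫 = Ideal.span {cobordantT' u w, algebraMap S (cobordantAlgebra' u w) z, W})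
    {a : ℕ} {g : cobordantAlgebra' u w} (hfg : algebraMap S (cobordantAlgebra' u w) f = cobordantT' u w ^ a * g)
    (hTg : ¬ cobordantT' u w ∣ g)
    (hord : iotaOrd (Localization.AtPrime 𝔫) (algebraMap _ (Localization.AtPrime 𝔫) g) = iotaOrd S f) :
    IsIsolatedPosition (Localization.AtPrime 𝔫) (algebraMap (cobordantAlgebra' u w) (Localization.AtPrime 𝔫) g) :=
  isIsolatedPosition_transform_aux p k₀ S hd hf0 hf2 P hfP hE hP1 hPm hyxz hrk hPeq hb hfν hfν1 hadm hc hh hf (funext hpres)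
    (fun m => hJ m) 𝔫 hV W hW h𝔫 hfg hTg hord

end Iota3

end Summit.ResolutionOfSingularities.ResolutionOfSingularities.Cruxes.HypersurfaceCentreConstruction.LocalEngine

end
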